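import Literature.Probability.Percolation.TriQuadProtection
import Literature.Probability.Percolation.TriUQuadArc
import Literature.Probability.Percolation.ArmSeparationIntFrame
import HarnessLib

/-!
# The fence of a protected lowest crossing in the U-shaped half-annulus (top-side tips)

Topic `Literature/Probability/Percolation`; family `crit-perc`, statement **crit-perc.S16**
(`Literature.Probability.Percolation.triTheta_exponent`). The deterministic core of Kesten's
"small extension" / free-space step for the half-plane region `U_{k,N}` (`uQuad k N`), in the
form of P. Nolin, EJP 13 (2008), §4.2 Def. 6 and §4.4, proof of Lemma 15 [arXiv 0711.4948:
Lemma 14] ("by considering a black circuit in the annuli … we can construct a small extension of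
`c_u`"), for the canonical lowest open crossing `γ` of a stage of the construction of
`TriQuadStages.lean` / `TriQuadProtection.lean` whose tip `l` lies on the **top side** of the
inner arc, away from its corners.

Let `P = openStop ω u` be the examined set and let the frame of scale `M` about `l` be open in the
configuration `ω ∪ D'`, `D' = P ∪ (U ∪ I)ᶜ` (`triForcedFrame`; `I = uInner k` is the inner
half-box, whose sites are NOT forced, so that the part of the frame inside `I` is really open).
Then (`uFence_top`) the bottom crossing `SS` of the frame lies inside `I` and is open in `ω`, and
some site of it is joined **by an `ω`-open path of `U ∪ I`** to a site of `γ` — hence, through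
`γ` and the rerouting lemma, to the arm. The mechanism (cf. `trap_exists_fence`,
`ArmSeparationFrame.lean`, for the trapezoid): follow the right, top and left crossings of the
frame from a common site `i₀ ∈ SS ∩ SE` until the first site of `γ`; along the way every site is
either in `SE ∩ I` or **high** — in `U`, off `γ`, and not joined to the left real segment off `γ`
(`uLow`) — because (`TriUQuadArc.lean`) the arc beyond the tip is not joined to `uB` off `γ`, high
and low sites are never adjacent, and a high site next to `I` is an arc site beyond the tip, next
to which only `SE` (not `SW`) passes. High sites are off `P ⊆ uLow ∪ γ`
(`openStop_subset_uLow_union`, from `explored_subset_low`), hence really open.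

## References

* P. Nolin, Near-critical percolation in two dimensions, *Electron. J. Probab.* 13 (2008), §4.2
  Def. 6, §4.4 proof of Lemma 15 [arXiv 0711.4948: Def. 6, Lemma 14] [Nolin2008].
* H. Kesten, Scaling relations for 2D-percolation, *Comm. Math. Phys.* 109 (1987), Lemma 2
  [KestenScalingCMP1987].

## Mathlib / tree

Tree: `FrameData` (+ `exists_mem_K`, `exists_mem_SN_SW`, `exists_mem_SS_SW`, bounds), `nonempty_frameData`,
`PathIn.inter_of_invariant` (`ArmSeparationFrame.lean`), `FrameData.exists_mem_SN_SE`,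
`exists_mem_SS_SE`, `Yr`, `pathIn_Yr` (`ArmSeparationIntFrame.lean`), `triForcedFrame` (`TriForcedFrame.lean`),
`TriQuad.openStop`, `canonSet`, `canonStart`, `canonSupport`, `canonSupport_spec`,
`exists_crossing_canonSet`, `hasCanon_of_pathIn` (`TriQuadProtection.lean`),
`TriQuad.explored_subset_low`, `subset_explored_sdiff`, `anchored_stages` (`TriQuadStages.lean`),
`uHt`, `mem_uL_iff`, `arcPt_uHt`, `exists_pathIn_arc_lt`, `not_joined_uB_of_gt`
(`TriUQuadArc.lean`), `PathIn.exit` (`SitePaths.lean`), `triGraph_adj_coord`.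
-/

noncomputable section

open Set

namespace Literature.Probability.Percolation

open LatticeModels

/-! ### More frame API: the union of the top, left and right crossings -/

namespace FrameData

variable {z : Site 2} {k : ℕ} {ω : SiteConfig (Site 2)} (F : FrameData z k ω)

/-- The union of the top, left and right crossings. [folklore] -/
def R3 : Set (Site 2) := F.SN ∪ F.SW ∪ F.SE

/-- `R3 ⊆ K`. [folklore] -/
theorem R3_subset_K : F.R3 ⊆ F.K := by
  rintro v ((hv | hv) | hv)
  · exact Or.inl (Or.inl (Or.inl hv))
  · exact Or.inl (Or.inr hv)
  · exact Or.inr hv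

/-- `R3` is connected from the base point of the right crossing. [folklore] -/
theorem pathIn_R3 (hk : 1 ≤ k) {w : Site 2} (hw : w ∈ F.R3) : PathIn triGraph F.R3 F.xE w := by
  obtain ⟨p₁, hp₁N, hp₁E⟩ := F.exists_mem_SN_SE hk
  obtain ⟨p₂, hp₂N, hp₂W⟩ := F.exists_mem_SN_SW hk
  have hNR : F.SN ⊆ F.R3 := fun _ h => Or.inl (Or.inl h)
  have hWR : F.SW ⊆ F.R3 := fun _ h => Or.inl (Or.inr h)
  have hER : F.SE ⊆ F.R3 := fun _ h => Or.inr h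
  have toN : ∀ w ∈ F.SN, PathIn triGraph F.R3 F.xE w := fun w hw =>
    ((F.tightE p₁ hp₁E).mono hER).trans (((F.tightN p₁ hp₁N).symm.trans (F.tightN w hw)).mono hNR)
  rcases hw with (hw | hw) | hw
  · exact toN w hw
  · exact (toN p₂ hp₂N).trans (((F.tightW p₂ hp₂W).symm.trans (F.tightW w hw)).mono hWR)
  · exact (F.tightE w hw).mono hER

end FrameData

/-! ### Low sites of the U-shaped region relative to a crossing -/

/-- **The sites below a crossing `S`**: joined to the left real segment `uB` by a path of
`U ∖ S`. [cite: Nolin2008, §4.4, proof of Lemma 15 (arXiv 0711.4948: Lemma 14)] -/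
def uLow (k N : ℕ) (S : Set (Site 2)) : Set (Site 2) :=
  {v | ∃ b ∈ uB k N, PathIn triGraph ((↑(uSites k N) : Set (Site 2)) \ S) b v}

/-- Low sites lie in `U ∖ S`. [folklore] -/
theorem uLow_subset {k N : ℕ} {S : Set (Site 2)} : uLow k N S ⊆ (↑(uSites k N) : Set (Site 2)) \ S := by
  rintro v ⟨b, -, hp⟩; exact hp.right_mem

/-- A site of `U ∖ S` adjacent to a low site is low. [folklore] -/
theorem uLow_step {k N : ℕ} {S : Set (Site 2)} {v w : Site 2} (hv : v ∈ uLow k N S)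
    (hw : w ∈ (↑(uSites k N) : Set (Site 2))) (hwS : w ∉ S) (hvw : triGraph.Adj v w) : w ∈ uLow k N S := by
  obtain ⟨b, hb, hp⟩ := hv
  exact ⟨b, hb, hp.tail hvw ⟨hw, hwS⟩⟩

variable {k N : ℕ}

/-- **The examined set lies on or below the canonical crossing**: if an open crossing avoids
`N_u`, then `openStop ω u ⊆ uLow γ ∪ γ` for the canonical support `γ` of stage `u + 1`
(`explored_subset_low`; `N_u` is anchored). [cite: Nolin2008, §4.4, proof of Lemma 15 (arXiv 0711.4948: Lemma 14)] -/
theorem openStop_subset_uLow_union (hk : 1 ≤ k) (hkN : k + 1 ≤ N) {ω : Set (Site 2)} {u : ℕ}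
    (h : (uQuad k N hk hkN).LRPath (ω \ ↑((uQuad k N hk hkN).stages ω u))) :
    (↑((uQuad k N hk hkN).openStop ω u) : Set (Site 2)) ⊆
      uLow k N ((uQuad k N hk hkN).canonSupport ((uQuad k N hk hkN).canonSet ω u)) ∪
        (uQuad k N hk hkN).canonSupport ((uQuad k N hk hkN).canonSet ω u) := by
  classical
  set Q := uQuad k N hk hkN with hQ
  obtain ⟨x, hx, y, hy, hp⟩ := TriQuad.exists_crossing_canonSet h
  have hcan : Q.HasCanon (Q.canonSet ω u) := TriQuad.hasCanon_of_pathIn hx hy hp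
  obtain ⟨-, hSγ, -, -, -⟩ := TriQuad.canonSupport_spec hcan
  have hSγ' : Q.canonSupport (Q.canonSet ω u) ⊆ ↑Q.U ∩ (ω \ ↑(Q.stages ω u)) := fun v hv => (hSγ hv).1
  intro v hv
  have hvE : v ∈ Q.explored (ω \ ↑(Q.stages ω u)) := by
    rcases Finset.mem_union.1 (Finset.mem_coe.1 hv) with hv | hv
    · exact TriQuad.subset_explored_sdiff (TriQuad.anchored_stages ω u) ω hv
    · exact hv
  rcases TriQuad.explored_subset_low hSγ' hvE with h' | h'
  · exact Or.inr h'
  · exact Or.inl h'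

/-! ### The route invariant (abstract over the four crossings of the frame) -/

/-- **The fence route, abstractly.** Quad `uQuad k N`, stage `u` with an open crossing avoiding
`N_u`, canonical support `γ` with tip `l`; `D' = openStop ω u ∪ (U ∪ I)ᶜ`. Let `X, Y, Z, W` be
sets of sites open in `ω ∪ D'` (the four crossings of a frame about `l`) such that: `X ⊆ I`;
`Y, W ⊆ I ∪ U`; `Z ⊆ U` misses the arc; the arc sites of `Y` lie beyond the tip; no site of `W`
is adjacent to a site of `Y ∩ I`, nor (inside `I`) to an arc site beyond the tip; `Y ∪ Z ∪ W` is
connected from `i₀ ∈ Y ∩ I` and contains a site of `γ`. Then `i₀` is joined to a site of `γ` by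
an `ω`-open path of `U ∪ I`: along the route, before the first site of `γ`, every site is in
`Y ∩ I` or high (in `U`, off `γ`, not in `uLow γ`), and high sites are off `openStop ω u`, hence
really open. [cite: Nolin2008, §4.4, proof of Lemma 15 (arXiv 0711.4948: Lemma 14)] -/
theorem uFence_core (hk : 1 ≤ k) (hkN : k + 1 ≤ N) {ω : Set (Site 2)} {u : ℕ}
    (h : (uQuad k N hk hkN).LRPath (ω \ ↑((uQuad k N hk hkN).stages ω u)))
    {X Y Z W : Set (Site 2)}
    (hξ : Y ∪ Z ∪ W ⊆ ω ∪ (↑((uQuad k N hk hkN).openStop ω u) ∪ (↑(uSites k N) ∪ uInner k)ᶜ))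
    (hY : ∀ v ∈ Y, v ∈ uInner k ∨ v ∈ (↑(uSites k N) : Set (Site 2)))
    (hZ : Z ⊆ ↑(uSites k N)) (hW : ∀ v ∈ W, v ∈ uInner k ∨ v ∈ (↑(uSites k N) : Set (Site 2)))
    (hYarc : ∀ b ∈ Y, b ∈ uL k N →
      uHt k ((uQuad k N hk hkN).canonStart ((uQuad k N hk hkN).canonSet ω u)) < uHt k b)
    (hZarc : ∀ b ∈ Z, b ∉ uL k N)
    (hYW : ∀ a ∈ Y, a ∈ uInner k → ∀ b ∈ W, ¬ triGraph.Adj a b)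
    (harcW : ∀ a ∈ uL k N, uHt k ((uQuad k N hk hkN).canonStart ((uQuad k N hk hkN).canonSet ω u)) < uHt k a →
      ∀ b ∈ W, b ∈ uInner k → ¬ triGraph.Adj a b)
    {i₀ : Site 2} (hi₀Y : i₀ ∈ Y) (hi₀I : i₀ ∈ uInner k) (hXi : i₀ ∈ X)
    (hroute : ∀ t ∈ Y ∪ Z ∪ W, PathIn triGraph (Y ∪ Z ∪ W) i₀ t)
    (htarget : ∃ t ∈ (uQuad k N hk hkN).canonSupport ((uQuad k N hk hkN).canonSet ω u), t ∈ Y ∪ Z ∪ W) :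
    ∃ i ∈ X, ∃ g ∈ (uQuad k N hk hkN).canonSupport ((uQuad k N hk hkN).canonSet ω u),
      PathIn triGraph (ω ∩ (↑(uSites k N) ∪ uInner k)) i g := by
  classical
  set Q := uQuad k N hk hkN with hQ
  set l := Q.canonStart (Q.canonSet ω u) with hl
  set Sγ := Q.canonSupport (Q.canonSet ω u) with hSγdef
  set P : Finset (Site 2) := Q.openStop ω u with hPdef
  set U : Set (Site 2) := ↑(uSites k N) with hUdef
  set I : Set (Site 2) := uInner k with hIdef
  set D' : Set (Site 2) := ↑P ∪ (U ∪ I)ᶜ with hD'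
  set R3 : Set (Site 2) := Y ∪ Z ∪ W with hR3
  -- the canonical crossing
  obtain ⟨x, hx, y₀, hy₀, hp₀⟩ := TriQuad.exists_crossing_canonSet h
  have hcan : Q.HasCanon (Q.canonSet ω u) := TriQuad.hasCanon_of_pathIn hx hy₀ hp₀
  obtain ⟨hlL, hSγS, ⟨y, hy, hpγ⟩, -, honly⟩ := TriQuad.canonSupport_spec hcan
  have hlL' : l ∈ uL k N := hlL
  have hSγU : Sγ ⊆ U := fun v hv => (hSγS hv).1.1
  have hSγω : Sγ ⊆ ω := fun v hv => (hSγS hv).1.2.1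
  have hlγ : l ∈ Sγ := hpγ.left_mem
  have honly' : ∀ v ∈ Sγ, v ∈ uL k N → v = l := honly
  have hPU : (↑P : Set (Site 2)) ⊆ U := fun v hv => Finset.mem_coe.2 (TriQuad.openStop_subset ω u (Finset.mem_coe.1 hv))
  have hUI : ∀ v, v ∈ U → v ∈ I → False := fun v hvU hvI => ((mem_coe_uSites.1 hvU).2 hvI)
  have hDI : ∀ v ∈ I, v ∉ D' := by
    rintro v hvI (hv | hv)
    · exact hUI v (hPU hv) hvI
    · exact hv (Or.inr hvI)
  -- low and high sites
  set Low := uLow k N Sγ with hLow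
  have hPLow : (↑P : Set (Site 2)) ⊆ Low ∪ Sγ := openStop_subset_uLow_union hk hkN h
  have highOpen : ∀ v ∈ R3, v ∈ U → v ∉ Low → v ∉ Sγ → v ∈ ω := by
    intro v hvK hvU hvL hvS
    rcases hξ hvK with hv | hv
    · exact hv
    · rcases hv with hv | hv
      · rcases hPLow hv with h' | h'
        · exact absurd h' hvL
        · exact absurd h' hvS
      · exact absurd (Or.inl hvU) hv
  -- arc sites adjacent to the inner box
  have arc_of_adj : ∀ {a b : Site 2}, a ∈ I → b ∈ U → triGraph.Adj a b → b ∈ uL k N :=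
    fun ha hb hab => ⟨hb, _, ha, hab⟩
  -- high arc sites lie beyond the tip
  have ht_of_high : ∀ {a : Site 2}, a ∈ uL k N → a ∉ Low → a ∉ Sγ → uHt k l < uHt k a := by
    intro a haL haLow haS
    by_contra hle
    push Not at hle
    rcases hle.lt_or_eq with hlt | heq
    · exact haLow (exists_pathIn_arc_lt hk hkN honly' haL hlt)
    · have h1 := (arcPt_uHt hk hkN haL).1
      have h2 := (arcPt_uHt hk hkN hlL').1
      rw [heq, h2] at h1
      exact haS (h1 ▸ hlγ)
  have hR_UI : ∀ v ∈ R3, v ∈ I ∨ v ∈ U := by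
    rintro v ((hv | hv) | hv)
    · exact hY v hv
    · exact Or.inr (hZ hv)
    · exact hW v hv
  -- the invariant along the route
  set Inv : Set (Site 2) := (Y ∩ I) ∪ {v | v ∈ U ∧ v ∉ Low ∧ v ∉ Sγ} with hInv
  have hstep : ∀ a b, a ∈ Sγᶜ ∩ R3 → a ∈ Inv → b ∈ Sγᶜ ∩ R3 → triGraph.Adj a b → b ∈ Inv := by
    rintro a b ⟨-, haR⟩ haInv ⟨hbS, hbR⟩ hab
    rcases haInv with ⟨haY, haI⟩ | ⟨haU, haLow, haS⟩
    · -- from a site of `Y` inside the inner box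
      rcases hR_UI b hbR with hbI | hbU
      · left
        refine ⟨?_, hbI⟩
        rcases hbR with (hbY | hbZ) | hbW
        · exact hbY
        · exact absurd hbI fun hbI => hUI b (hZ hbZ) hbI
        · exact absurd hab (hYW a haY haI b hbW)
      · right
        have hbL : b ∈ uL k N := arc_of_adj haI hbU hab
        have hbY : b ∈ Y := by
          rcases hbR with (hbY | hbZ) | hbW
          · exact hbY
          · exact absurd hbL (hZarc b hbZ)
          · exact absurd hab (hYW a haY haI b hbW)
        exact ⟨hbU, not_joined_uB_of_gt hk hkN hSγU hlL' hy hpγ honly' hbL (hYarc b hbY hbL), hbS⟩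
    · -- from a high site
      rcases hR_UI b hbR with hbI | hbU
      · left
        refine ⟨?_, hbI⟩
        have haL : a ∈ uL k N := arc_of_adj hbI haU hab.symm
        have hta := ht_of_high haL haLow haS
        rcases hbR with (hbY | hbZ) | hbW
        · exact hbY
        · exact absurd hbI fun hbI => hUI b (hZ hbZ) hbI
        · exact absurd hab (harcW a haL hta b hbW hbI)
      · right
        refine ⟨hbU, fun hbLow => haLow ?_, hbS⟩
        exact uLow_step hbLow haU haS hab.symm
  -- target and route, cut at the first site of `γ`
  obtain ⟨t, htγ, htR⟩ := htarget
  have hi₀γ : i₀ ∈ Sγᶜ := fun hi => hUI i₀ (hSγU hi) hi₀I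
  obtain ⟨a, g, -, hgγ, -, hag, hpre⟩ := (hroute t htR).exit (R := Sγᶜ) hi₀γ (fun ht => ht htγ)
  simp only [mem_compl_iff, not_not] at hgγ
  have hpre' := hpre.inter_of_invariant (G := Inv) (Or.inl ⟨hi₀Y, hi₀I⟩) hstep
  have hopen : (Sγᶜ ∩ R3) ∩ Inv ⊆ ω ∩ (U ∪ I) := by
    rintro v ⟨⟨hvS, hvR⟩, hvInv⟩
    rcases hvInv with ⟨hvY, hvI⟩ | ⟨hvU, hvLow, hvS'⟩
    · refine ⟨?_, Or.inr hvI⟩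
      rcases hξ hvR with hv | hv
      · exact hv
      · exact absurd hv (hDI v hvI)
    · exact ⟨highOpen v hvR hvU hvLow hvS', Or.inl hvU⟩
  exact ⟨i₀, hXi, g, hgγ, (hpre'.mono hopen).tail hag ⟨hSγω hgγ, Or.inl (hSγU hgγ)⟩⟩

/-! ### The fence for a top-side tip -/

/-- **The fence of the canonical lowest crossing, top-side tip.** Quad `uQuad k N`, stage `u`
with an open crossing avoiding `N_u`, canonical support `γ` with tip `l = canonStart` on the top
side of the inner arc (`l₁ = k`), at distance `> 2M` from its corners; `2M ≤ k`, `k + 2M ≤ N`,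
`1 ≤ M`. If the frame of scale `M` about `l` is open in `ω ∪ D'`,
`D' = openStop ω u ∪ (U ∪ I)ᶜ`, then its bottom crossing `SS` lies in `I ∩ ω`, and some site of
`SS` is joined to a site of `γ` by an `ω`-open path of `U ∪ I` (route: `SE`, `SN`, `SW`). [cite: Nolin2008, §4.2 Def. 6 and §4.4 proof of Lemma 15 ("small extension of c_u"; arXiv 0711.4948: Def. 6, Lemma 14)] [cite: KestenScalingCMP1987, Lemma 2] -/
theorem uFence_top (hk : 1 ≤ k) (hkN : k + 1 ≤ N) {ω : Set (Site 2)} {u M : ℕ} (hM : 1 ≤ M)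
    (hMk : 2 * M ≤ k) (hMN : k + 2 * M ≤ N)
    (h : (uQuad k N hk hkN).LRPath (ω \ ↑((uQuad k N hk hkN).stages ω u)))
    (hl1 : (uQuad k N hk hkN).canonStart ((uQuad k N hk hkN).canonSet ω u) 1 = k)
    (hl0 : -(k : ℤ) + 1 + 2 * M ≤ (uQuad k N hk hkN).canonStart ((uQuad k N hk hkN).canonSet ω u) 0)
    (hl0' : (uQuad k N hk hkN).canonStart ((uQuad k N hk hkN).canonSet ω u) 0 + 2 * M ≤ k - 1)
    (hframe : ω ∈ triForcedFrame (↑((uQuad k N hk hkN).openStop ω u) ∪ (↑(uSites k N) ∪ uInner k)ᶜ)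
      ((uQuad k N hk hkN).canonStart ((uQuad k N hk hkN).canonSet ω u)) M) :
    ∃ F : FrameData ((uQuad k N hk hkN).canonStart ((uQuad k N hk hkN).canonSet ω u)) M
        (ω ∪ (↑((uQuad k N hk hkN).openStop ω u) ∪ (↑(uSites k N) ∪ uInner k)ᶜ)),
      F.SS ⊆ uInner k ∩ ω ∧
      ∃ i₀ ∈ F.SS, ∃ g ∈ (uQuad k N hk hkN).canonSupport ((uQuad k N hk hkN).canonSet ω u),
        PathIn triGraph (ω ∩ (↑(uSites k N) ∪ uInner k)) i₀ g := by
  classical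
  set Q := uQuad k N hk hkN with hQ
  set l := Q.canonStart (Q.canonSet ω u) with hl
  set Sγ := Q.canonSupport (Q.canonSet ω u) with hSγdef
  set P : Finset (Site 2) := Q.openStop ω u with hPdef
  set U : Set (Site 2) := ↑(uSites k N) with hUdef
  set I : Set (Site 2) := uInner k with hIdef
  have hk' : (1 : ℤ) ≤ k := by exact_mod_cast hk
  have hM' : (1 : ℤ) ≤ M := by exact_mod_cast hM
  have hMk' : 2 * (M : ℤ) ≤ k := by exact_mod_cast hMk
  have hMN' : (k : ℤ) + 2 * M ≤ N := by exact_mod_cast hMN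
  obtain ⟨F⟩ := nonempty_frameData hframe
  -- the canonical crossing (for the target)
  obtain ⟨x, hx, y₀, hy₀, hp₀⟩ := TriQuad.exists_crossing_canonSet h
  have hcan : Q.HasCanon (Q.canonSet ω u) := TriQuad.hasCanon_of_pathIn hx hy₀ hp₀
  obtain ⟨-, hSγS, ⟨y, hy, hpγ⟩, -, -⟩ := TriQuad.canonSupport_spec hcan
  have hSγU : Sγ ⊆ U := fun v hv => (hSγS hv).1.1
  have hPU : (↑P : Set (Site 2)) ⊆ U := fun v hv => Finset.mem_coe.2 (TriQuad.openStop_subset ω u (Finset.mem_coe.1 hv))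
  have hUI : ∀ v, v ∈ U → v ∈ I → False := fun v hvU hvI => ((mem_coe_uSites.1 hvU).2 hvI)
  -- the parameter of the tip
  have hl0ne : l 0 ≠ -(k : ℤ) := by omega
  have hHtl : uHt k l = 2 * k + l 0 := by
    unfold uHt; rw [if_neg hl0ne, if_pos hl1]
  -- geometry of the four crossings
  have bS : ∀ v ∈ F.SS, v ∈ I := fun v hv => by
    have := F.boundsS hv
    show v ∈ uInner k
    rw [mem_uInner]; omega
  have bN : ∀ v ∈ F.SN, v ∈ U ∧ (k : ℤ) + 1 ≤ v 1 := fun v hv => by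
    have := F.boundsN hv
    refine ⟨mem_coe_uSites.2 ⟨⟨by omega, by omega, by omega, by omega⟩, fun h' => ?_⟩, by omega⟩
    rw [mem_uInner] at h'; omega
  have bE : ∀ v ∈ F.SE, (v ∈ I ∨ v ∈ U) ∧ l 0 + M ≤ v 0 := fun v hv => by
    have := F.boundsE hv
    refine ⟨?_, this.1⟩
    by_cases hv1 : v 1 ≤ (k : ℤ) - 1
    · left; show v ∈ uInner k; rw [mem_uInner]; omega
    · right
      refine mem_coe_uSites.2 ⟨⟨by omega, by omega, by omega, by omega⟩, fun h' => ?_⟩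
      rw [mem_uInner] at h'; omega
  have bW : ∀ v ∈ F.SW, (v ∈ I ∨ v ∈ U) ∧ v 0 + M ≤ l 0 := fun v hv => by
    have := F.boundsW hv
    refine ⟨?_, by omega⟩
    by_cases hv1 : v 1 ≤ (k : ℤ) - 1
    · left; show v ∈ uInner k; rw [mem_uInner]; omega
    · right
      refine mem_coe_uSites.2 ⟨⟨by omega, by omega, by omega, by omega⟩, fun h' => ?_⟩
      rw [mem_uInner] at h'; omega
  -- arc sites of `SE` lie beyond the tip; `SN` has none; `SW` is far from both
  have htE : ∀ b ∈ F.SE, b ∈ uL k N → uHt k l < uHt k b := by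
    intro b hbE hbL
    have hb := F.boundsE hbE
    rw [mem_uL_iff hk hkN] at hbL
    have hb0 : b 0 ≠ -(k : ℤ) := by omega
    have hb1 : b 1 = k := by omega
    have : uHt k b = 2 * k + b 0 := by unfold uHt; rw [if_neg hb0, if_pos hb1]
    rw [this, hHtl]; omega
  have hNarc : ∀ b ∈ F.SN, b ∉ uL k N := by
    intro b hbN hbL
    have hb := (bN b hbN).2
    rw [mem_uL_iff hk hkN] at hbL; omega
  have hEW : ∀ a ∈ F.SE, a ∈ uInner k → ∀ b ∈ F.SW, ¬ triGraph.Adj a b := by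
    intro a haE _ b hbW hab
    have := triGraph_adj_coord hab 0
    have := (bE a haE).2; have := (bW b hbW).2; omega
  have harcW : ∀ a ∈ uL k N, uHt k l < uHt k a → ∀ b ∈ F.SW, b ∈ uInner k → ¬ triGraph.Adj a b := by
    intro a haL hta b hbW _ hab
    have hab0 := triGraph_adj_coord hab 0
    have hbw := (bW b hbW).2
    rw [mem_uL_iff hk hkN] at haL
    rw [hHtl] at hta
    unfold uHt at hta
    split_ifs at hta with h1 h2 <;> omega
  -- start and target
  obtain ⟨i₀, hi₀S, hi₀E⟩ := F.exists_mem_SS_SE hM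
  have hyout : y 0 ≤ l 0 - 2 * M ∨ l 0 + 2 * M ≤ y 0 ∨ y 1 ≤ l 1 - 2 * M ∨ l 1 + 2 * M ≤ y 1 := by
    obtain ⟨hyU, hy'⟩ := hy
    rw [mem_coe_uSites] at hyU
    rcases hy' with h' | h' | h' <;> omega
  obtain ⟨t, htγ, htK⟩ := F.exists_mem_K hM (s := l) (by omega) hyout hpγ
  have htR : t ∈ F.SE ∪ F.SN ∪ F.SW := by
    rcases htK with ((htN | htS) | htW) | htE
    · exact Or.inl (Or.inr htN)
    · exact absurd (bS t htS) fun htI => hUI t (hSγU htγ) htI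
    · exact Or.inr htW
    · exact Or.inl (Or.inl htE)
  -- the route set `SE ∪ SN ∪ SW` is `R3` reordered
  have hR3eq : F.SE ∪ F.SN ∪ F.SW = F.R3 := by
    ext v; simp only [FrameData.R3, mem_union]; tauto
  have hroute : ∀ t ∈ F.SE ∪ F.SN ∪ F.SW, PathIn triGraph (F.SE ∪ F.SN ∪ F.SW) i₀ t := fun t ht => by
    rw [hR3eq] at ht ⊢
    exact (F.pathIn_R3 hM (Or.inr hi₀E)).symm.trans (F.pathIn_R3 hM ht)
  have hξ : F.SE ∪ F.SN ∪ F.SW ⊆ ω ∪ (↑P ∪ (U ∪ I)ᶜ) := by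
    rw [hR3eq]; exact fun v hv => F.K_subset (F.R3_subset_K hv)
  obtain ⟨i, hi, g, hg, hpath⟩ := uFence_core hk hkN h (X := F.SS) (Y := F.SE) (Z := F.SN) (W := F.SW) hξ
    (fun v hv => (bE v hv).1) (fun v hv => (bN v hv).1) (fun v hv => (bW v hv).1) htE hNarc hEW harcW
    hi₀E (bS i₀ hi₀S) hi₀S hroute ⟨t, htγ, htR⟩
  refine ⟨F, fun v hv => ⟨bS v hv, ?_⟩, i, hi, g, hg, hpath⟩
  rcases (F.SS_sub hv).2 with hv' | hv'
  · exact hv'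
  · exfalso
    rcases hv' with hv' | hv'
    · exact hUI v (hPU hv') (bS v hv)
    · exact hv' (Or.inr (bS v hv))

/-! ### The fence for a left-side tip -/

/-- **The fence of the canonical lowest crossing, left-side tip** (`l₀ = -k`, `2M ≤ l₁`,
`l₁ + 2M ≤ k - 1`): the right crossing `SE` of the forced frame lies in `I ∩ ω` and one of its
sites is joined to `γ` by an `ω`-open path of `U ∪ I` (route: `SN`, `SW`, `SS`). [cite: Nolin2008, §4.2 Def. 6 and §4.4 proof of Lemma 15 (arXiv 0711.4948: Def. 6, Lemma 14)] [cite: KestenScalingCMP1987, Lemma 2] -/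
theorem uFence_left (hk : 1 ≤ k) (hkN : k + 1 ≤ N) {ω : Set (Site 2)} {u M : ℕ} (hM : 1 ≤ M)
    (hMN : k + 2 * M ≤ N)
    (h : (uQuad k N hk hkN).LRPath (ω \ ↑((uQuad k N hk hkN).stages ω u)))
    (hl0 : (uQuad k N hk hkN).canonStart ((uQuad k N hk hkN).canonSet ω u) 0 = -(k : ℤ))
    (hl1 : 2 * (M : ℤ) ≤ (uQuad k N hk hkN).canonStart ((uQuad k N hk hkN).canonSet ω u) 1)
    (hl1' : (uQuad k N hk hkN).canonStart ((uQuad k N hk hkN).canonSet ω u) 1 + 2 * M ≤ k - 1)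
    (hframe : ω ∈ triForcedFrame (↑((uQuad k N hk hkN).openStop ω u) ∪ (↑(uSites k N) ∪ uInner k)ᶜ)
      ((uQuad k N hk hkN).canonStart ((uQuad k N hk hkN).canonSet ω u)) M) :
    ∃ F : FrameData ((uQuad k N hk hkN).canonStart ((uQuad k N hk hkN).canonSet ω u)) M
        (ω ∪ (↑((uQuad k N hk hkN).openStop ω u) ∪ (↑(uSites k N) ∪ uInner k)ᶜ)),
      F.SE ⊆ uInner k ∩ ω ∧
      ∃ i₀ ∈ F.SE, ∃ g ∈ (uQuad k N hk hkN).canonSupport ((uQuad k N hk hkN).canonSet ω u),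
        PathIn triGraph (ω ∩ (↑(uSites k N) ∪ uInner k)) i₀ g := by
  classical
  set Q := uQuad k N hk hkN with hQ
  set l := Q.canonStart (Q.canonSet ω u) with hl
  set Sγ := Q.canonSupport (Q.canonSet ω u) with hSγdef
  set P : Finset (Site 2) := Q.openStop ω u with hPdef
  set U : Set (Site 2) := ↑(uSites k N) with hUdef
  set I : Set (Site 2) := uInner k with hIdef
  have hk' : (1 : ℤ) ≤ k := by exact_mod_cast hk
  have hM' : (1 : ℤ) ≤ M := by exact_mod_cast hM
  have hMN' : (k : ℤ) + 2 * M ≤ N := by exact_mod_cast hMN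
  obtain ⟨F⟩ := nonempty_frameData hframe
  obtain ⟨x, hx, y₀, hy₀, hp₀⟩ := TriQuad.exists_crossing_canonSet h
  have hcan : Q.HasCanon (Q.canonSet ω u) := TriQuad.hasCanon_of_pathIn hx hy₀ hp₀
  obtain ⟨-, hSγS, ⟨y, hy, hpγ⟩, -, -⟩ := TriQuad.canonSupport_spec hcan
  have hSγU : Sγ ⊆ U := fun v hv => (hSγS hv).1.1
  have hPU : (↑P : Set (Site 2)) ⊆ U := fun v hv => Finset.mem_coe.2 (TriQuad.openStop_subset ω u (Finset.mem_coe.1 hv))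
  have hUI : ∀ v, v ∈ U → v ∈ I → False := fun v hvU hvI => ((mem_coe_uSites.1 hvU).2 hvI)
  have hHtl : uHt k l = l 1 := by unfold uHt; rw [if_pos hl0]
  -- geometry
  have bE : ∀ v ∈ F.SE, v ∈ I := fun v hv => by
    have := F.boundsE hv
    show v ∈ uInner k
    rw [mem_uInner]; omega
  have bW : ∀ v ∈ F.SW, v ∈ U ∧ v 0 + M ≤ -(k : ℤ) := fun v hv => by
    have := F.boundsW hv
    refine ⟨mem_coe_uSites.2 ⟨⟨by omega, by omega, by omega, by omega⟩, fun h' => ?_⟩, by omega⟩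
    rw [mem_uInner] at h'; omega
  have bN : ∀ v ∈ F.SN, (v ∈ I ∨ v ∈ U) ∧ l 1 + M ≤ v 1 := fun v hv => by
    have := F.boundsN hv
    refine ⟨?_, by omega⟩
    by_cases hv0 : -(k : ℤ) + 1 ≤ v 0
    · left; show v ∈ uInner k; rw [mem_uInner]; omega
    · right
      refine mem_coe_uSites.2 ⟨⟨by omega, by omega, by omega, by omega⟩, fun h' => ?_⟩
      rw [mem_uInner] at h'; omega
  have bS : ∀ v ∈ F.SS, (v ∈ I ∨ v ∈ U) ∧ v 1 + M ≤ l 1 := fun v hv => by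
    have := F.boundsS hv
    refine ⟨?_, by omega⟩
    by_cases hv0 : -(k : ℤ) + 1 ≤ v 0
    · left; show v ∈ uInner k; rw [mem_uInner]; omega
    · right
      refine mem_coe_uSites.2 ⟨⟨by omega, by omega, by omega, by omega⟩, fun h' => ?_⟩
      rw [mem_uInner] at h'; omega
  have htN : ∀ b ∈ F.SN, b ∈ uL k N → uHt k l < uHt k b := by
    intro b hbN hbL
    have hb := F.boundsN hbN
    rw [mem_uL_iff hk hkN] at hbL
    have hb0 : b 0 = -(k : ℤ) := by omega
    have : uHt k b = b 1 := by unfold uHt; rw [if_pos hb0]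
    rw [this, hHtl]; omega
  have hWarc : ∀ b ∈ F.SW, b ∉ uL k N := by
    intro b hbW hbL
    have hb := (bW b hbW).2
    rw [mem_uL_iff hk hkN] at hbL; omega
  have hNS : ∀ a ∈ F.SN, a ∈ uInner k → ∀ b ∈ F.SS, ¬ triGraph.Adj a b := by
    intro a haN _ b hbS hab
    have := triGraph_adj_coord hab 1
    have := (bN a haN).2; have := (bS b hbS).2; omega
  have harcS : ∀ a ∈ uL k N, uHt k l < uHt k a → ∀ b ∈ F.SS, b ∈ uInner k → ¬ triGraph.Adj a b := by
    intro a haL hta b hbS hbI hab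
    have hab0 := triGraph_adj_coord hab 0
    have hab1 := triGraph_adj_coord hab 1
    have hbs := (bS b hbS).2
    have hbb := F.boundsS hbS
    have hbI' : -(k : ℤ) + 1 ≤ b 0 := by rw [show (b ∈ uInner k) = _ from rfl, mem_uInner] at hbI; omega
    rw [mem_uL_iff hk hkN] at haL
    rw [hHtl] at hta
    unfold uHt at hta
    split_ifs at hta with h1 h2 <;> omega
  -- start and target
  obtain ⟨i₀, hi₀N, hi₀E⟩ := F.exists_mem_SN_SE hM
  have hyout : y 0 ≤ l 0 - 2 * M ∨ l 0 + 2 * M ≤ y 0 ∨ y 1 ≤ l 1 - 2 * M ∨ l 1 + 2 * M ≤ y 1 := by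
    obtain ⟨hyU, hy'⟩ := hy
    rw [mem_coe_uSites] at hyU
    rcases hy' with h' | h' | h' <;> omega
  obtain ⟨t, htγ, htK⟩ := F.exists_mem_K hM (s := l) (by omega) hyout hpγ
  have htR : t ∈ F.SN ∪ F.SW ∪ F.SS := by
    rcases htK with ((htN | htS) | htW) | htE
    · exact Or.inl (Or.inl htN)
    · exact Or.inr htS
    · exact Or.inl (Or.inr htW)
    · exact absurd (bE t htE) fun htI => hUI t (hSγU htγ) htI
  have hYeq : F.SN ∪ F.SW ∪ F.SS = F.Y := by
    ext v; simp only [FrameData.Y, mem_union]; tauto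
  have hroute : ∀ t ∈ F.SN ∪ F.SW ∪ F.SS, PathIn triGraph (F.SN ∪ F.SW ∪ F.SS) i₀ t := fun t ht => by
    rw [hYeq] at ht ⊢
    exact F.pathIn_Y hM (Or.inl (Or.inl hi₀N)) ht
  have hξ : F.SN ∪ F.SW ∪ F.SS ⊆ ω ∪ (↑P ∪ (U ∪ I)ᶜ) := by
    rw [hYeq]; exact fun v hv => F.K_subset (F.Y_subset_K hv)
  obtain ⟨i, hi, g, hg, hpath⟩ := uFence_core hk hkN h (X := F.SE) (Y := F.SN) (Z := F.SW) (W := F.SS) hξ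
    (fun v hv => (bN v hv).1) (fun v hv => (bW v hv).1) (fun v hv => (bS v hv).1) htN hWarc hNS harcS
    hi₀N (bE i₀ hi₀E) hi₀E hroute ⟨t, htγ, htR⟩
  refine ⟨F, fun v hv => ⟨bE v hv, ?_⟩, i, hi, g, hg, hpath⟩
  rcases (F.SE_sub hv).2 with hv' | hv'
  · exact hv'
  · exfalso
    rcases hv' with hv' | hv'
    · exact hUI v (hPU hv') (bE v hv)
    · exact hv' (Or.inr (bE v hv))

/-! ### The fence for a right-side tip -/

/-- **The fence of the canonical lowest crossing, right-side tip** (`l₀ = k`, `2M ≤ l₁`,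
`l₁ + 2M ≤ k - 1`): the left crossing `SW` of the forced frame lies in `I ∩ ω` and one of its
sites is joined to `γ` by an `ω`-open path of `U ∪ I` (route: `SS`, `SE`, `SN` — beyond a right
tip the arc continues downwards). [cite: Nolin2008, §4.2 Def. 6 and §4.4 proof of Lemma 15 (arXiv 0711.4948: Def. 6, Lemma 14)] [cite: KestenScalingCMP1987, Lemma 2] -/
theorem uFence_right (hk : 1 ≤ k) (hkN : k + 1 ≤ N) {ω : Set (Site 2)} {u M : ℕ} (hM : 1 ≤ M)
    (hMN : k + 2 * M ≤ N)
    (h : (uQuad k N hk hkN).LRPath (ω \ ↑((uQuad k N hk hkN).stages ω u)))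
    (hl0 : (uQuad k N hk hkN).canonStart ((uQuad k N hk hkN).canonSet ω u) 0 = k)
    (hl1 : 2 * (M : ℤ) ≤ (uQuad k N hk hkN).canonStart ((uQuad k N hk hkN).canonSet ω u) 1)
    (hl1' : (uQuad k N hk hkN).canonStart ((uQuad k N hk hkN).canonSet ω u) 1 + 2 * M ≤ k - 1)
    (hframe : ω ∈ triForcedFrame (↑((uQuad k N hk hkN).openStop ω u) ∪ (↑(uSites k N) ∪ uInner k)ᶜ)
      ((uQuad k N hk hkN).canonStart ((uQuad k N hk hkN).canonSet ω u)) M) :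
    ∃ F : FrameData ((uQuad k N hk hkN).canonStart ((uQuad k N hk hkN).canonSet ω u)) M
        (ω ∪ (↑((uQuad k N hk hkN).openStop ω u) ∪ (↑(uSites k N) ∪ uInner k)ᶜ)),
      F.SW ⊆ uInner k ∩ ω ∧
      ∃ i₀ ∈ F.SW, ∃ g ∈ (uQuad k N hk hkN).canonSupport ((uQuad k N hk hkN).canonSet ω u),
        PathIn triGraph (ω ∩ (↑(uSites k N) ∪ uInner k)) i₀ g := by
  classical
  set Q := uQuad k N hk hkN with hQ
  set l := Q.canonStart (Q.canonSet ω u) with hl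
  set Sγ := Q.canonSupport (Q.canonSet ω u) with hSγdef
  set P : Finset (Site 2) := Q.openStop ω u with hPdef
  set U : Set (Site 2) := ↑(uSites k N) with hUdef
  set I : Set (Site 2) := uInner k with hIdef
  have hk' : (1 : ℤ) ≤ k := by exact_mod_cast hk
  have hM' : (1 : ℤ) ≤ M := by exact_mod_cast hM
  have hMN' : (k : ℤ) + 2 * M ≤ N := by exact_mod_cast hMN
  obtain ⟨F⟩ := nonempty_frameData hframe
  obtain ⟨x, hx, y₀, hy₀, hp₀⟩ := TriQuad.exists_crossing_canonSet h
  have hcan : Q.HasCanon (Q.canonSet ω u) := TriQuad.hasCanon_of_pathIn hx hy₀ hp₀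
  obtain ⟨-, hSγS, ⟨y, hy, hpγ⟩, -, -⟩ := TriQuad.canonSupport_spec hcan
  have hSγU : Sγ ⊆ U := fun v hv => (hSγS hv).1.1
  have hPU : (↑P : Set (Site 2)) ⊆ U := fun v hv => Finset.mem_coe.2 (TriQuad.openStop_subset ω u (Finset.mem_coe.1 hv))
  have hUI : ∀ v, v ∈ U → v ∈ I → False := fun v hvU hvI => ((mem_coe_uSites.1 hvU).2 hvI)
  have hl0ne : l 0 ≠ -(k : ℤ) := by omega
  have hl1ne : l 1 ≠ (k : ℤ) := by omega
  have hHtl : uHt k l = 4 * k - 1 - l 1 := by unfold uHt; rw [if_neg hl0ne, if_neg hl1ne]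
  -- geometry
  have bW : ∀ v ∈ F.SW, v ∈ I := fun v hv => by
    have := F.boundsW hv
    show v ∈ uInner k
    rw [mem_uInner]; omega
  have bE : ∀ v ∈ F.SE, v ∈ U ∧ (k : ℤ) + M ≤ v 0 := fun v hv => by
    have := F.boundsE hv
    refine ⟨mem_coe_uSites.2 ⟨⟨by omega, by omega, by omega, by omega⟩, fun h' => ?_⟩, by omega⟩
    rw [mem_uInner] at h'; omega
  have bS : ∀ v ∈ F.SS, (v ∈ I ∨ v ∈ U) ∧ v 1 + M ≤ l 1 := fun v hv => by
    have := F.boundsS hv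
    refine ⟨?_, by omega⟩
    by_cases hv0 : v 0 ≤ (k : ℤ) - 1
    · left; show v ∈ uInner k; rw [mem_uInner]; omega
    · right
      refine mem_coe_uSites.2 ⟨⟨by omega, by omega, by omega, by omega⟩, fun h' => ?_⟩
      rw [mem_uInner] at h'; omega
  have bN : ∀ v ∈ F.SN, (v ∈ I ∨ v ∈ U) ∧ l 1 + M ≤ v 1 := fun v hv => by
    have := F.boundsN hv
    refine ⟨?_, by omega⟩
    by_cases hv0 : v 0 ≤ (k : ℤ) - 1
    · left; show v ∈ uInner k; rw [mem_uInner]; omega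
    · right
      refine mem_coe_uSites.2 ⟨⟨by omega, by omega, by omega, by omega⟩, fun h' => ?_⟩
      rw [mem_uInner] at h'; omega
  have htS : ∀ b ∈ F.SS, b ∈ uL k N → uHt k l < uHt k b := by
    intro b hbS hbL
    have hb := F.boundsS hbS
    rw [mem_uL_iff hk hkN] at hbL
    have hb0 : b 0 ≠ -(k : ℤ) := by omega
    have hb1 : b 1 ≠ (k : ℤ) := by omega
    have : uHt k b = 4 * k - 1 - b 1 := by unfold uHt; rw [if_neg hb0, if_neg hb1]
    rw [this, hHtl]; omega
  have hEarc : ∀ b ∈ F.SE, b ∉ uL k N := by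
    intro b hbE hbL
    have hb := (bE b hbE).2
    rw [mem_uL_iff hk hkN] at hbL; omega
  have hSN : ∀ a ∈ F.SS, a ∈ uInner k → ∀ b ∈ F.SN, ¬ triGraph.Adj a b := by
    intro a haS _ b hbN hab
    have := triGraph_adj_coord hab 1
    have := (bS a haS).2; have := (bN b hbN).2; omega
  have harcN : ∀ a ∈ uL k N, uHt k l < uHt k a → ∀ b ∈ F.SN, b ∈ uInner k → ¬ triGraph.Adj a b := by
    intro a haL hta b hbN hbI hab
    have hab0 := triGraph_adj_coord hab 0
    have hab1 := triGraph_adj_coord hab 1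
    have hbn := (bN b hbN).2
    have hbb := F.boundsN hbN
    have hbI' : b 0 ≤ (k : ℤ) - 1 := by rw [show (b ∈ uInner k) = _ from rfl, mem_uInner] at hbI; omega
    rw [mem_uL_iff hk hkN] at haL
    rw [hHtl] at hta
    unfold uHt at hta
    split_ifs at hta with h1 h2 <;> omega
  -- start and target
  obtain ⟨i₀, hi₀S, hi₀W⟩ := F.exists_mem_SS_SW hM
  have hyout : y 0 ≤ l 0 - 2 * M ∨ l 0 + 2 * M ≤ y 0 ∨ y 1 ≤ l 1 - 2 * M ∨ l 1 + 2 * M ≤ y 1 := by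
    obtain ⟨hyU, hy'⟩ := hy
    rw [mem_coe_uSites] at hyU
    rcases hy' with h' | h' | h' <;> omega
  obtain ⟨t, htγ, htK⟩ := F.exists_mem_K hM (s := l) (by omega) hyout hpγ
  have htR : t ∈ F.SS ∪ F.SE ∪ F.SN := by
    rcases htK with ((htN | htS) | htW) | htE
    · exact Or.inr htN
    · exact Or.inl (Or.inl htS)
    · exact absurd (bW t htW) fun htI => hUI t (hSγU htγ) htI
    · exact Or.inl (Or.inr htE)
  have hYreq : F.SS ∪ F.SE ∪ F.SN = F.Yr := by
    ext v; simp only [FrameData.Yr, mem_union]; tauto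
  have hroute : ∀ t ∈ F.SS ∪ F.SE ∪ F.SN, PathIn triGraph (F.SS ∪ F.SE ∪ F.SN) i₀ t := fun t ht => by
    rw [hYreq] at ht ⊢
    exact F.pathIn_Yr hM (Or.inl (Or.inr hi₀S)) ht
  have hξ : F.SS ∪ F.SE ∪ F.SN ⊆ ω ∪ (↑P ∪ (U ∪ I)ᶜ) := by
    rintro v ((hv | hv) | hv)
    · exact F.K_subset (Or.inl (Or.inl (Or.inr hv)))
    · exact F.K_subset (Or.inr hv)
    · exact F.K_subset (Or.inl (Or.inl (Or.inl hv)))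
  obtain ⟨i, hi, g, hg, hpath⟩ := uFence_core hk hkN h (X := F.SW) (Y := F.SS) (Z := F.SE) (W := F.SN) hξ
    (fun v hv => (bS v hv).1) (fun v hv => (bE v hv).1) (fun v hv => (bN v hv).1) htS hEarc hSN harcN
    hi₀S (bW i₀ hi₀W) hi₀W hroute ⟨t, htγ, htR⟩
  refine ⟨F, fun v hv => ⟨bW v hv, ?_⟩, i, hi, g, hg, hpath⟩
  rcases (F.SW_sub hv).2 with hv' | hv'
  · exact hv'
  · exfalso
    rcases hv' with hv' | hv'
    · exact hUI v (hPU hv') (bW v hv)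
    · exact hv' (Or.inr (bW v hv))

end Literature.Probability.Percolation
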